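import Summits.CriticalPhenomena.Ising3DConformalLimit.Theorems.SubPtolemyInterlacingInterlacingBalancedSuffices

/-!
# RESTATE candidates for crux stmt-CriticalPhenomena-15702 (`SubPtolemyInterlacing.Interlacing`) — lead c1, cycle 1

Evidence file (NOT a proposal): the two weaker signatures the route's assembly actually consumes, elaborated against the
tree, each with a sorry-free `example` showing that the landed transfer theorems
(`Theorems/SubPtolemyInterlacingInterlacingBalancedSuffices.lean`, p140149) turn it into the sub-problem together with the
route's other two cruxes. A planner can paste either `def` body into `ledger route edit … --restate stmt-CriticalPhenomena-15702`.
-/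

noncomputable section

namespace Summit.CriticalPhenomena.Ising3DConformalLimit.Cruxes.Interlacing.Restate

open Literature.Probability.LatticeModels
open Summit.CriticalPhenomena.Ising3DConformalLimit.Theses.SubPtolemyInterlacing
open Summit.CriticalPhenomena.Ising3DConformalLimit.Cruxes.Interlacing.Sketch

/-- Candidate A (weakest; literally the hypothesis of `transfer_ising3D_of_eventualBalanced`): the sub-Ptolemy inequality
at the balanced DYADIC axis quadruples `(0, 2N, 3N, 6N)·e₁`, `N = 2^{k+1}`, EVENTUALLY in `k`. -/
def InterlacingBalancedDyadic : Prop :=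
  ∃ K : ℕ, ∀ k : ℕ, K ≤ k →
    criticalCorr 3 4 ![Pi.single 0 ((0 : ℕ) : ℤ), Pi.single 0 ((2 * 2 ^ (k + 1) : ℕ) : ℤ),
        Pi.single 0 ((3 * 2 ^ (k + 1) : ℕ) : ℤ), Pi.single 0 ((6 * 2 ^ (k + 1) : ℕ) : ℤ)] *
        (criticalCorr 3 2 ![Pi.single 0 ((0 : ℕ) : ℤ), Pi.single 0 ((3 * 2 ^ (k + 1) : ℕ) : ℤ)] *
          criticalCorr 3 2 ![Pi.single 0 ((2 * 2 ^ (k + 1) : ℕ) : ℤ), Pi.single 0 ((6 * 2 ^ (k + 1) : ℕ) : ℤ)]) ≤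
      criticalCorr 3 2 ![Pi.single 0 ((0 : ℕ) : ℤ), Pi.single 0 ((2 * 2 ^ (k + 1) : ℕ) : ℤ)] *
          criticalCorr 3 2 ![Pi.single 0 ((3 * 2 ^ (k + 1) : ℕ) : ℤ), Pi.single 0 ((6 * 2 ^ (k + 1) : ℕ) : ℤ)] *
        (criticalCorr 3 2 ![Pi.single 0 ((0 : ℕ) : ℤ), Pi.single 0 ((6 * 2 ^ (k + 1) : ℕ) : ℤ)] *
          criticalCorr 3 2 ![Pi.single 0 ((2 * 2 ^ (k + 1) : ℕ) : ℤ), Pi.single 0 ((3 * 2 ^ (k + 1) : ℕ) : ℤ)])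

/-- Candidate B (cleaner, slightly stronger than A, still free of the `Δ_ε > 1` bands): the sub-Ptolemy inequality at
EVERY balanced axis quadruple `(0, 2N, 3N, 6N)·e₁`, `N ≥ 1` (cross-ratio `z = ½` at every scale). -/
def InterlacingBalanced : Prop :=
  ∀ N : ℕ, 1 ≤ N →
    criticalCorr 3 4 ![Pi.single 0 ((0 : ℕ) : ℤ), Pi.single 0 ((2 * N : ℕ) : ℤ),
        Pi.single 0 ((3 * N : ℕ) : ℤ), Pi.single 0 ((6 * N : ℕ) : ℤ)] *
        (criticalCorr 3 2 ![Pi.single 0 ((0 : ℕ) : ℤ), Pi.single 0 ((3 * N : ℕ) : ℤ)] *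
          criticalCorr 3 2 ![Pi.single 0 ((2 * N : ℕ) : ℤ), Pi.single 0 ((6 * N : ℕ) : ℤ)]) ≤
      criticalCorr 3 2 ![Pi.single 0 ((0 : ℕ) : ℤ), Pi.single 0 ((2 * N : ℕ) : ℤ)] *
          criticalCorr 3 2 ![Pi.single 0 ((3 * N : ℕ) : ℤ), Pi.single 0 ((6 * N : ℕ) : ℤ)] *
        (criticalCorr 3 2 ![Pi.single 0 ((0 : ℕ) : ℤ), Pi.single 0 ((6 * N : ℕ) : ℤ)] *
          criticalCorr 3 2 ![Pi.single 0 ((2 * N : ℕ) : ℤ), Pi.single 0 ((3 * N : ℕ) : ℤ)])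

/-- Candidate A closes the sub-problem with the route's other two cruxes (landed transfer, by name). -/
example : InterlacingBalancedDyadic → SubPtolemyFloor → MoebiusLimit → _root_.Ising3DConformalLimit :=
  transfer_ising3D_of_eventualBalanced

/-- Candidate B closes the sub-problem with the route's other two cruxes. -/
example (hB : InterlacingBalanced) (hF : SubPtolemyFloor) (hML : MoebiusLimit) : _root_.Ising3DConformalLimit :=
  transfer_ising3D_of_balanced 0 (fun N _ hN => hB N hN) hF hML

/-- The filed crux implies both candidates (they are genuine weakenings). -/
example (hI : Interlacing) : InterlacingBalancedDyadic := transfer_eventualBalanced_of_interlacing hI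

example (hI : Interlacing) : InterlacingBalanced := fun N hN =>
  Summit.CriticalPhenomena.Ising3DConformalLimit.Theorems.interlacingForcesU4_interlacing_balanced hI N hN

end Summit.CriticalPhenomena.Ising3DConformalLimit.Cruxes.Interlacing.Restate

end
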